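import Summits.ABC.IUTFork.Repair.RHLabelGlobal
import Summits.ABC.IUTFork.Repair.CandMochizuki40TwoPlace
import HarnessLib

/-!
# R-H ROUND 1 row 22 «label-global» — the TWO-PLACE witnesses (k4 (a) of the CARD in the kernel): H⋆_22 is STRICTLY
# WEAKER than every packetwise / placewise supplier, and still misses some essentially-global truth

PROOF-ONLY companion (no definitions) of `Summits/ABC/IUTFork/Repair/RHLabelGlobal.lean` (p460565/p462073; decl of record
`RH.LabelGlobal.HStarLabelGlobal`, author abc-iut-lens-dual-3), written by the row-22 typer abc-iut-rh-typ-6 (D-0079 RESCUE.H round 1).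
Bed: abc-iut-rp-m4 / c312's two-place setting `Cor312Vol.TwoPlace.twoSetting p c d` (two places, honest `q` with `qLocal = −c` at every
nonzero label, Θ-images with per-place log-shell inflation `d : twoIndex.VQ → ℕ`, `thetaLocal (j, v) = −(j² − d v)·c`, `l⋆ = 2`).

* `two_labelSlack` — the per-label GLOBAL slack is `Θ_j − Q_j = (d 0 + d 1 + 2 − 2j²)·c`;
* `hStarLabelGlobal_two_iff` — **H⋆_22 ⟺ `6 ≤ d 0 + d 1`** (binding label `j = 2`), against `Statement ⟺ 3 ≤ d 0 + d 1`
  (`two_statement_iff`), `Placewise ⟺ ∀ v, 3 ≤ 2·d v` (`placewise_two_iff`), licence at `v ⟺ 3 ≤ d v` (`two_licenceAt_iff`);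
* at the profile `2·depth = (0, 6)` (a DEEP place `0` with no inflation, a GOOD place `1` with inflation `6`):
  `hStar_two_deepGood` — H⋆_22 HOLDS; `not_placewise_two_deepGood`, `not_licence_two_deepGood`, `not_pointwise_two_deepGood` — the place
  marginal, the (xi-f) licence and READING 0 all FAIL (at the deep place, label 2): **`hStar_and_not_placewise_two_deepGood`** = the CARD's
  k4 (a) «weaker than I06⋆/licence: the deficit at one place is paid, AT THE SAME LABEL, by another place's shell inflation» — the
  cross-place compensation that (EssGlIq) calls essential is exactly what H⋆_22 retains;
* at the profile of record `depth = (0, 3)`: `statement_and_not_hStar_two_depth` — Statement TRUE (`3 ≤ 3`), H⋆_22 FALSE (`¬ 6 ≤ 3`),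
  Placewise FALSE: the typed Corollary can hold with NEITHER marginal — H⋆_22 drops the cross-LABEL compensation (strictly stronger than
  the Statement, as `statement_and_not_hStarLabelGlobal_shellSetting_two` already showed on one place);
* `hStar_not_placewise_satisfiable` — packaged T-c: typed Thm. 3.11 ∧ `BridgeHyps` ∧ `|log(q)| > 0` ∧ H⋆_22 ∧ Statement ∧ ¬Placewise ∧
  ¬Licence jointly SATISFIABLE (p = 2, c = log 2, d = (0, 6)).

HONEST FRAMING: toy beds over the frozen interface; H⋆_22 is a claim-tagged HYPOTHESIS, never asserted; nothing here asserts that abc is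
proved or refuted; no side is taken on [IUTchIII] Cor. 3.12 or on any author; typed ≠ proved ≠ endorsed.
-/

noncomputable section

open Set

namespace Summit.ABC.IUTFork.Repair.RH.LabelGlobal

open Thm311 Cor312 Cor312Vol Cor312Vol.NaiveProv Cor312Vol.TwoPlace Literature.IUT.LogThetaLattice
  Summit.ABC.IUTFork.Repair.CandMochizuki40

section TwoPlace

variable (p : ℕ) [hp : Fact p.Prime] (c : ℝ) (d : twoIndex.VQ → ℕ)

/-- The per-label GLOBAL slack of the two-place bed at label `j = i+1`: summing `thetaLocal − qLocal = (d v − j² + 1)·c` over the two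
places gives `Θ_j − Q_j = (d 0 + d 1 + 2 − 2j²)·c`. [folklore] -/
theorem two_labelSlack (i : Fin twoIndex.lstar) :
    (∑ᶠ vQ : twoIndex.VQ, ((twoSetting p c d).thetaLocal (Setting.labelSucc i) vQ).untopD 0) -
        ∑ᶠ vQ : twoIndex.VQ, (twoSetting p c d).qLocal (Setting.labelSucc i) vQ =
      ((d 0 : ℝ) + (d 1 : ℝ) + 2 - 2 * (jsq (T := twoIndex) (Setting.labelSucc (T := twoIndex) i) : ℝ)) * c := by
  simp only [two_thetaLocal, two_qLocal, WithTop.untopD_coe]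
  rw [finsum_eq_sum_of_fintype, finsum_eq_sum_of_fintype, Fin.sum_univ_two, Fin.sum_univ_two]
  push_cast
  ring

/-- **H⋆_22 on the two-place bed is `6 ≤ d 0 + d 1`** (`c > 0`): the label-`2` global slack `(d 0 + d 1 − 6)·c` must be `≥ 0`; the
label-`1` slack `(d 0 + d 1)·c` always is.  Compare `Statement ⟺ 3 ≤ d 0 + d 1` (`two_statement_iff`: the label AVERAGE),
`Placewise ⟺ ∀ v, 3 ≤ 2·d v` (`placewise_two_iff`), licence at `v ⟺ 3 ≤ d v` (`two_licenceAt_iff`). [folklore] -/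
theorem hStarLabelGlobal_two_iff (hc : 0 < c) : HStarLabelGlobal (twoSetting p c d) ↔ 6 ≤ d 0 + d 1 := by
  rw [hStarLabelGlobal_iff_slack_nonneg]
  constructor
  · intro h
    have h4 := h 1
    have e := two_labelSlack p c d 1
    rw [two_jsq.2] at e
    have h4' : 0 ≤ ((d 0 : ℝ) + (d 1 : ℝ) + 2 - 2 * ((4 : ℕ) : ℝ)) * c := le_of_le_of_eq h4 e
    push_cast at h4'
    by_contra hd
    have hd' : (d 0 : ℝ) + (d 1 : ℝ) ≤ 5 := by
      have : d 0 + d 1 ≤ 5 := by omega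
      exact_mod_cast this
    nlinarith
  · intro hd i
    have hd' : (6 : ℝ) ≤ (d 0 : ℝ) + (d 1 : ℝ) := by exact_mod_cast hd
    have hj : (jsq (T := twoIndex) (Setting.labelSucc (T := twoIndex) i) : ℝ) ≤ 4 := by exact_mod_cast two_jsq_le i
    have hfac : 0 ≤ (d 0 : ℝ) + (d 1 : ℝ) + 2 - 2 * (jsq (T := twoIndex) (Setting.labelSucc (T := twoIndex) i) : ℝ) := by
      linarith
    exact le_of_le_of_eq (mul_nonneg hfac hc.le) (two_labelSlack p c d i).symm

/-- On the two-place bed H⋆_22 ⟹ the Statement directly by the numbers (`6 ≤ D → 3 ≤ D`), as `statement_of_hStarLabelGlobal` says in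
general. [folklore] -/
theorem statement_of_hStarLabelGlobal_two (h : HStarLabelGlobal (twoSetting p c d)) :
    Summit.ABC.IUTFork.Cor312.Setting.Statement (twoSetting p c d) :=
  statement_of_hStarLabelGlobal (two_thetaFinite p c d) h

/-! ### The DEEP-plus-GOOD profile `2·depth = (0, 6)`: H⋆_22 holds with NO placewise supplier -/

/-- The profile `v ↦ 2·depth v = (0, 6)`: values. [folklore] -/
theorem two_depth_val : (fun vQ : twoIndex.VQ => 2 * depth vQ) 0 = 0 ∧ (fun vQ : twoIndex.VQ => 2 * depth vQ) 1 = 6 := by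
  refine ⟨?_, ?_⟩ <;> simp only [depth_val.1, depth_val.2]

/-- **H⋆_22 HOLDS at `d = (0, 6)`** (`0 + 6 ≥ 6`: at label `2` the deep place's deficit `−3c` is paid by the good place's surplus `+3c`).
[folklore] -/
theorem hStar_two_deepGood (hc : 0 < c) : HStarLabelGlobal (twoSetting p c fun vQ => 2 * depth vQ) := by
  rw [hStarLabelGlobal_two_iff p c _ hc, depth_val.1, depth_val.2]

/-- … the Statement holds there too (`3 ≤ 6`). [folklore] -/
theorem statement_two_deepGood (hc : 0 < c) :
    Summit.ABC.IUTFork.Cor312.Setting.Statement (twoSetting p c fun vQ => 2 * depth vQ) :=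
  statement_of_hStarLabelGlobal_two p c _ (hStar_two_deepGood p c hc)

/-- **… while the PLACE marginal FAILS** (local portion at the deep place `0`: `3 ≤ 2·0` is false). [folklore] -/
theorem not_placewise_two_deepGood (hc : 0 < c) : ¬ Placewise (twoSetting p c fun vQ => 2 * depth vQ) := fun h => by
  have h0 := (placewise_two_iff p c _ hc).1 h 0
  rw [depth_val.1] at h0
  exact absurd h0 (by decide)

/-- **… the (xi-f) LICENCE FAILS** (at the deep place: `B_1 ⊄ B_4` at label `2`). [folklore] -/
theorem not_licence_two_deepGood : ¬ Thm311ToCor312.Licence (twoSetting p c fun vQ => 2 * depth vQ) := fun h => by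
  have h0 := (two_licenceAt_iff p c (fun vQ => 2 * depth vQ) 0).1 fun i => h i 0
  rw [depth_val.1] at h0
  exact absurd h0 (by decide)

/-- **… and READING 0 (the packetwise volume inequality) FAILS** at the cell (label `2`, place `0`): `−c ≤ −4c` is false. So H⋆_22 is
NOT implied-by-and-equivalent-to the packetwise reading: it is strictly weaker. [folklore] -/
theorem not_pointwise_two_deepGood (hc : 0 < c) :
    ¬ ∀ (i : Fin twoIndex.lstar) (vQ : twoIndex.VQ),
      (twoSetting p c fun vQ => 2 * depth vQ).qLocal (Setting.labelSucc i) vQ ≤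
        ((twoSetting p c fun vQ => 2 * depth vQ).thetaLocal (Setting.labelSucc i) vQ).untopD 0 := fun h => by
  have h20 := h 1 0
  simp only [two_thetaLocal, two_qLocal, WithTop.untopD_coe, two_jsq.2, depth_val.1] at h20
  push_cast at h20
  nlinarith

/-- **k4 (a) of the CARD in the kernel — H⋆_22 ∧ ¬Placewise ∧ ¬Licence ∧ ¬READING 0 at one setting.**  The label marginal holds
where every place-local supplier fails: the deficit of the deep place is compensated AT THE SAME LABEL by the good place's inflation —
the cross-place compensation (EssGlIq) calls essential, retained by H⋆_22 and lost by every packetwise / placewise row of the R-H table.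
Together with `placewise_and_not_hStarLabelGlobal_shellSetting_two` (Placewise ∧ ¬H⋆_22 on one place): the two marginals are
INCOMPARABLE. [folklore] -/
theorem hStar_and_not_placewise_two_deepGood (hc : 0 < c) :
    HStarLabelGlobal (twoSetting p c fun vQ => 2 * depth vQ) ∧ ¬ Placewise (twoSetting p c fun vQ => 2 * depth vQ) ∧
      ¬ Thm311ToCor312.Licence (twoSetting p c fun vQ => 2 * depth vQ) ∧
      ¬ ∀ (i : Fin twoIndex.lstar) (vQ : twoIndex.VQ),
        (twoSetting p c fun vQ => 2 * depth vQ).qLocal (Setting.labelSucc i) vQ ≤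
          ((twoSetting p c fun vQ => 2 * depth vQ).thetaLocal (Setting.labelSucc i) vQ).untopD 0 :=
  ⟨hStar_two_deepGood p c hc, not_placewise_two_deepGood p c hc, not_licence_two_deepGood p c, not_pointwise_two_deepGood p c hc⟩

/-! ### The profile of record `depth = (0, 3)`: the Statement holds with NEITHER marginal -/

/-- **At `d = (0, 3)`: Statement TRUE (`3 ≤ 3`), H⋆_22 FALSE (`¬ 6 ≤ 3`), Placewise FALSE** — the typed Corollary can hold while BOTH
marginal readings fail: H⋆_22 drops the cross-LABEL compensation (label `1`'s surplus `+3c` against label `2`'s deficit `−3c`), the place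
marginal drops the cross-PLACE one.  H⋆_22 is strictly stronger than the Statement (second witness, two places). [folklore] -/
theorem statement_and_not_hStar_two_depth (hc : 0 < c) :
    Summit.ABC.IUTFork.Cor312.Setting.Statement (twoSetting p c depth) ∧ ¬ HStarLabelGlobal (twoSetting p c depth) ∧
      ¬ Placewise (twoSetting p c depth) := by
  refine ⟨two_statement p c hc, fun h => ?_, not_placewise_depth p c hc⟩
  have h6 := (hStarLabelGlobal_two_iff p c depth hc).1 h
  rw [depth_val.1, depth_val.2] at h6
  exact absurd h6 (by decide)

end TwoPlace

/-- **T-c (satisfiability) for «row 22 WITHOUT any placewise supplier»**: a full situation carrying the typed Theorem 3.11 and a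
Cor.-3.12 setting with the bridge hypotheses and `|log(q)| > 0` at which H⋆_22 and the Statement HOLD while the place marginal and the
(xi-f) licence FAIL — two places, `p = 2`, `c = log 2`, inflation profile `(0, 6)`. Neutral record over the frozen interface; no judgement
on print. [folklore] -/
theorem hStar_not_placewise_satisfiable :
    ∃ (T : ThetaIndex) (F : FullSituation T) (P : Cor312.Setting F.toLatticeSituation.toSituation),
      F.Statement ∧ BridgeHyps P ∧ P.AbsLogQPos ∧ HStarLabelGlobal P ∧ P.Statement ∧ ¬ Placewise P ∧
        ¬ Thm311ToCor312.Licence P := by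
  haveI : Fact (Nat.Prime 2) := ⟨Nat.prime_two⟩
  have hc : 0 < Real.log 2 := Real.log_pos (by norm_num)
  exact ⟨twoIndex, twoFull 2 (Real.log 2), twoSetting 2 (Real.log 2) (fun vQ => 2 * depth vQ), twoFull_statement 2 _,
    two_bridgeHyps 2 _ _ hc.le, two_absLogQPos 2 _ _ hc, hStar_two_deepGood 2 _ hc, statement_two_deepGood 2 _ hc,
    not_placewise_two_deepGood 2 _ hc, not_licence_two_deepGood 2 _⟩

end Summit.ABC.IUTFork.Repair.RH.LabelGlobal

end
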